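import Summits.HodgeConjecture.HodgeConjecture.Theorems.Ring2WeilCoverageCMTypeSetPairCount
import HarnessLib

/-!
# Weil-type family coverage — THEOREM F (F1) in closed form at residue level: for every `N_K`-balanced CM
# type set `S ⊆ (ℤ/m)ˣ`, `|S ∩ N_odd| ≡ n₋ = #{t ∈ N_K : t < m/2} (mod 2)` (every level `m > 2`)

research route conditional on HC_CM; not a corollary; Q11.4-sentence-2 already refuted in dim ≥ 3.

Ring 2, WEIL-TYPE FAMILY-COVERAGE CENSUS (`HOME/WEIL-FAMILY-COVERAGE.md` `## b01`, block b01.28 THEOREM F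
(F1) «for EVERY `K`-balanced CM type `Φ`: `wt(s_Φ) = |Φ ∩ N| ≡ n₋(M,K) := #{t ∈ U : t < M/2, χ_K(t) = −1}
(mod 2)`», owner ring2-b01), sequel of `Ring2WeilCoverageCMTypeSetPairCount` (the pair-count identity for
`Literature.AlgebraicGeometry.HodgeTheory.IsCMTypeSet m`).  Residue model (Aoki): `U = (ℤ/m)ˣ ⊆ ℤ/m` listed
by representatives `0 < u₁ < … < u_{φ(m)} < m`, complex conjugation `t ↦ −t`; the census's three CM type sets
are `Φ = S`, `N_K` (the residues acting as conjugation on the imaginary quadratic `K`; here ANY CM type set)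
and `N = N_odd` = the residues at ODD positions `u₁, u₃, …` (b01.23 Step 1 «alternation» / b01.28 (F0):
`N = {σ_t : Im σ_t(ξ₀) < 0}` for `ξ₀ = ζ^{g−1}/Φ′_M(ζ)` — this ANALYTIC identification is NOT proved here;
`N_odd` is taken by its combinatorial definition `below t := #{s ∈ U : s < t}` even).  Proved (no `decide`
except in the `M = 21` examples of §6):

* §1–§2 `isCMTypeSet_lower` (the lower half `{t ∈ U : 2t < m}` is a CM type set, `m > 2`),
  `two_mul_card_eq_card_units` (`2|S| = |U|` for every CM type set), `card_sdiff_comm` (`|A ∖ B| = |B ∖ A|`);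
* §3 `card_below_neg_add` (**`below(−t) + below(t) + 1 = |U|`** — the census's `pos(M − t) = 2g + 1 − pos(t)`),
  hence **`isCMTypeSet_nodd`: `N_odd` is a CM type set** (`|U|` even);
* §4 order statistics: `below` is strictly monotone / injective on `U`, maps the lower half onto
  `range |Lower|` (`image_below_lower`), so **`card_lower_inter_nodd`: `#{t ∈ Lower : below t even} = |Lower|/2`**;
* §5 **`card_inter_nodd_mod_two_eq` (THEOREM F (F1), closed form)**: for CM type sets `S, N_K` with
  `2·|S ∩ N_K| = |S|` (the `K`-balanced = Weil-signature-`(n,n)` condition),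
  `|S ∩ N_odd| ≡ #{t ∈ N_K : 2t < m} (mod 2)` — by two applications of the pair-count identity
  (`(S; N_odd, N_K)` and `(N_K; N_odd, Lower)`) and §4; in particular the bit is independent of `S`;
* §6 the census level `M = 21`: `N_odd = {1, 4, 8, 11, 16, 19}`, `n₋(21, ℚ(√-3)) = 3` (odd: NO),
  `n₋(21, ℚ(√-7)) = 2` (even: YES, row `W6.7.1`) — `decide` — and the two `M = 21` statements as instances of
  §5 (consistent with `Ring2WeilCoverageCMTypeSignParityLevel21`'s mod-`42` `decide` over all 64 types).

No `def` (the sets are written out; `local notation3` abbreviates them in this file only), no named fact, no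
`sorry`; nothing here is a statement about Hodge classes; `HC_CM` is used nowhere.  Residue conventions:
[cite: Aoki2002CMFermatType, §1 (p. 102) and §3 eq. (5) (p. 103)].
-/

namespace Summit.HodgeConjecture.Ring2WeilCoverage.CMTypeSetOddPositions

open Finset Literature.AlgebraicGeometry.HodgeTheory
open Summit.HodgeConjecture.Ring2WeilCoverage.CMTypeSetPairCount

variable {m : ℕ} [NeZero m]

/-- The unit residues `(ℤ/m)ˣ ⊆ ℤ/m` (as a `Finset`). -/
local notation3 (prettyPrint := false) "𝑈" =>
  (Finset.univ.filter fun t : ZMod m => t.val.Coprime m)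

/-- `below t` = the number of unit residues `s` with `s.val < t.val` (= position of `t` minus one in the
increasing list `0 < u₁ < u₂ < … < u_{φ(m)} < m`). -/
local notation3 (prettyPrint := false) "below " t:max =>
  (Finset.card (Finset.filter (fun s : ZMod m => s.val.Coprime m ∧ s.val < ZMod.val t) Finset.univ))

/-- The census's set `N` = the unit residues at ODD positions `u₁, u₃, u₅, …` (`below` even). -/
local notation3 (prettyPrint := false) "Nodd" =>
  (Finset.univ.filter fun t : ZMod m => t.val.Coprime m ∧
    Even (Finset.card (Finset.filter (fun s : ZMod m => s.val.Coprime m ∧ s.val < t.val) Finset.univ)))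

/-- The lower half `{t ∈ (ℤ/m)ˣ : t < m/2}`. -/
local notation3 (prettyPrint := false) "Lower" =>
  (Finset.univ.filter fun t : ZMod m => t.val.Coprime m ∧ 2 * t.val < m)

/-! ### §1 Unit residues: negation, the lower half -/

omit [NeZero m] in
/-- A unit residue is non-zero once `m > 1`. [folklore] -/
theorem ne_zero_of_coprime (hm : 1 < m) {t : ZMod m} (ht : t.val.Coprime m) : t ≠ 0 := by
  rintro rfl
  rw [ZMod.val_zero, Nat.coprime_zero_left] at ht
  omega

/-- `(−t).val = m − t.val` for a unit residue `t` (`m > 1`). [folklore] -/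
theorem val_neg_of_coprime (hm : 1 < m) {t : ZMod m} (ht : t.val.Coprime m) : (-t).val = m - t.val := by
  rw [ZMod.neg_val, if_neg (ne_zero_of_coprime hm ht)]

omit [NeZero m] in
/-- `2·t.val ≠ m` for a unit residue (`m > 2`). [folklore] -/
theorem two_mul_val_ne (hm : 2 < m) {t : ZMod m} (ht : t.val.Coprime m) : 2 * t.val ≠ m := by
  intro h
  have hdvd : t.val ∣ m := ⟨2, by omega⟩
  have h1 : t.val = 1 := Nat.Coprime.eq_one_of_dvd ht hdvd
  omega

/-- **The lower half is a CM type set** (`m > 2`): exactly one of `t, −t` has `2·val < m`.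
research route conditional on HC_CM; not a corollary; Q11.4-sentence-2 already refuted in dim ≥ 3. [folklore] -/
theorem isCMTypeSet_lower (hm : 2 < m) : IsCMTypeSet m Lower := by
  refine ⟨fun t ht => (mem_filter.mp ht).2.1, fun t ht => ?_⟩
  have hm1 : 1 < m := by omega
  have htlt : t.val < m := ZMod.val_lt t
  have hne := two_mul_val_ne hm ht
  simp only [mem_filter, mem_univ, true_and, not_and, not_lt]
  constructor
  · rintro ⟨-, h⟩ -
    rw [val_neg_of_coprime hm1 ht]; omega
  · intro h
    have h' := h (coprime_val_neg ht)
    rw [val_neg_of_coprime hm1 ht] at h'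
    exact ⟨ht, by omega⟩

/-! ### §2 Every CM type set has `|(ℤ/m)ˣ|/2` elements -/

/-- **`2·|S| = |(ℤ/m)ˣ|` for a CM type set `S`**: `(ℤ/m)ˣ = S ⊔ (−S)`.
research route conditional on HC_CM; not a corollary; Q11.4-sentence-2 already refuted in dim ≥ 3. [folklore] -/
theorem two_mul_card_eq_card_units {S : Finset (ZMod m)} (hS : IsCMTypeSet m S) :
    2 * S.card = Finset.card 𝑈 := by
  have hsub : S ⊆ 𝑈 := fun t ht => mem_filter.mpr ⟨mem_univ _, hS.1 t ht⟩
  have himg : S.image (fun t : ZMod m => -t) ⊆ 𝑈 := by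
    intro x hx
    obtain ⟨t, ht, rfl⟩ := mem_image.mp hx
    exact mem_filter.mpr ⟨mem_univ _, coprime_val_neg (hS.1 t ht)⟩
  have hdisj : Disjoint S (S.image fun t : ZMod m => -t) := by
    rw [Finset.disjoint_left]
    intro t ht hx
    obtain ⟨s, hs, hst⟩ := mem_image.mp hx
    exact ((hS.2 s (hS.1 s hs)).mp hs) (hst ▸ ht)
  have hcov : 𝑈 = S ∪ S.image (fun t : ZMod m => -t) := by
    refine Subset.antisymm (fun u hu => ?_) (union_subset hsub himg)
    have hu' := (mem_filter.mp hu).2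
    by_cases huS : u ∈ S
    · exact mem_union_left _ huS
    · have : -u ∈ S := by
        by_contra h
        exact huS (by have := hS.2 u hu'; tauto)
      exact mem_union_right _ (mem_image.mpr ⟨-u, this, neg_neg u⟩)
  rw [hcov, card_union_of_disjoint hdisj, card_image_of_injective _ neg_injective]
  ring

/-- Two CM type sets have the same cardinality, hence `|A ∖ B| = |B ∖ A|`.
research route conditional on HC_CM; not a corollary; Q11.4-sentence-2 already refuted in dim ≥ 3. [folklore] -/
theorem card_sdiff_comm {A B : Finset (ZMod m)} (hA : IsCMTypeSet m A) (hB : IsCMTypeSet m B) :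
    (A \ B).card = (B \ A).card := by
  have h := two_mul_card_eq_card_units hA
  rw [← two_mul_card_eq_card_units hB] at h
  have hA' := card_sdiff_add_card_inter A B
  have hB' := card_sdiff_add_card_inter B A
  rw [inter_comm] at hB'
  omega

/-! ### §3 Positions: `below (−t) + below t + 1 = |(ℤ/m)ˣ|`, and `Nodd` is a CM type set -/

/-- `below` read after negation: the units below `−t` are the negatives of the units above `t`. [folklore] -/
theorem card_below_neg (hm : 1 < m) {t : ZMod m} (ht : t.val.Coprime m) :
    below (-t) = (Finset.univ.filter fun s : ZMod m => s.val.Coprime m ∧ t.val < s.val).card := by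
  rw [← card_image_of_injective
    (Finset.univ.filter fun s : ZMod m => s.val.Coprime m ∧ t.val < s.val) neg_injective]
  congr 1
  ext x
  simp only [mem_filter, mem_univ, true_and, mem_image]
  rw [val_neg_of_coprime hm ht]
  constructor
  · rintro ⟨hx, hlt⟩
    refine ⟨-x, ⟨coprime_val_neg hx, ?_⟩, neg_neg x⟩
    rw [val_neg_of_coprime hm hx]
    have := ZMod.val_lt x
    omega
  · rintro ⟨s, ⟨hs, hlt⟩, rfl⟩
    refine ⟨coprime_val_neg hs, ?_⟩
    rw [val_neg_of_coprime hm hs]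
    have := ZMod.val_lt s
    have := ZMod.val_lt t
    omega

/-- Trichotomy count: `below t + 1 + #{s : t < s} = |(ℤ/m)ˣ|` for a unit residue `t`. [folklore] -/
theorem card_below_add (t : ZMod m) (ht : t.val.Coprime m) :
    below t + 1 + (Finset.univ.filter fun s : ZMod m => s.val.Coprime m ∧ t.val < s.val).card =
      Finset.card 𝑈 := by
  have h1 := card_filter_add_card_filter_not (s := 𝑈) (p := fun s : ZMod m => s.val < t.val)
  have e1 : (Finset.filter (fun s : ZMod m => s.val < t.val) 𝑈) =
      Finset.univ.filter fun s : ZMod m => s.val.Coprime m ∧ s.val < t.val := by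
    rw [filter_filter]
  have e2 : (Finset.filter (fun s : ZMod m => ¬ s.val < t.val) 𝑈) =
      insert t (Finset.univ.filter fun s : ZMod m => s.val.Coprime m ∧ t.val < s.val) := by
    ext s
    simp only [filter_filter, mem_filter, mem_univ, true_and, mem_insert, not_lt]
    constructor
    · rintro ⟨hs, hle⟩
      rcases Nat.lt_or_ge t.val s.val with h | h
      · exact Or.inr ⟨hs, h⟩
      · exact Or.inl (ZMod.val_injective m (le_antisymm h hle))
    · rintro (rfl | ⟨hs, hlt⟩)
      · exact ⟨ht, le_rfl⟩
      · exact ⟨hs, hlt.le⟩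
  have hnot : t ∉ (Finset.univ.filter fun s : ZMod m => s.val.Coprime m ∧ t.val < s.val) := by
    simp
  rw [e1, e2, card_insert_of_notMem hnot] at h1
  omega

/-- **`below (−t) + below t + 1 = |(ℤ/m)ˣ|`** (`pos(M − t) = 2g + 1 − pos(t)` of the census, b01.28 (F1)).
research route conditional on HC_CM; not a corollary; Q11.4-sentence-2 already refuted in dim ≥ 3. [folklore] -/
theorem card_below_neg_add (hm : 1 < m) {t : ZMod m} (ht : t.val.Coprime m) :
    below (-t) + below t + 1 = Finset.card 𝑈 := by
  rw [card_below_neg hm ht]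
  have := card_below_add t ht
  omega

/-- **`Nodd` is a CM type set** whenever `|(ℤ/m)ˣ|` is even (`m > 2`): the positions of `t` and `−t` have
opposite parities.  (By `Ring2WeilCoverage.CMTypeSignParity.mem_negSet_iff_conjugate_notMem` the census's
`N = {σ_t : Im σ_t(ξ₀) < 0}` is a CM type for ANY skew `ξ₀`; (F0) says it is this one.)
research route conditional on HC_CM; not a corollary; Q11.4-sentence-2 already refuted in dim ≥ 3. [folklore] -/
theorem isCMTypeSet_nodd (hm : 1 < m) (hU : Even (Finset.card 𝑈)) : IsCMTypeSet m Nodd := by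
  refine ⟨fun t ht => (mem_filter.mp ht).2.1, fun t ht => ?_⟩
  have hsum := card_below_neg_add hm ht
  simp only [mem_filter, mem_univ, true_and, not_and]
  constructor
  · rintro ⟨-, heven⟩ - heven'
    rcases hU with ⟨k, hk⟩; rcases heven with ⟨a, ha⟩; rcases heven' with ⟨b, hb⟩
    omega
  · intro h
    refine ⟨ht, ?_⟩
    have h' : ¬ Even (below (-t)) := h (coprime_val_neg ht)
    rcases hU with ⟨k, hk⟩
    rcases Nat.even_or_odd (below t) with he | ho
    · exact he
    · exfalso; apply h'
      rcases ho with ⟨b, hb⟩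
      exact ⟨k - b - 1, by omega⟩

/-! ### §4 Order statistics on the lower half: `#{t ∈ Lower : below t even} = |Lower|/2` -/

/-- `below` is strictly monotone in `val` on unit residues. [folklore] -/
theorem below_lt_below_of_val_lt {s s' : ZMod m} (hs : s.val.Coprime m) (h : s.val < s'.val) :
    below s < below s' := by
  apply card_lt_card
  rw [Finset.ssubset_iff_of_subset]
  · refine ⟨s, ?_, ?_⟩
    · exact mem_filter.mpr ⟨mem_univ _, hs, h⟩
    · simp
  · intro u hu
    simp only [mem_filter, mem_univ, true_and] at hu ⊢
    exact ⟨hu.1, lt_trans hu.2 h⟩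

/-- `below` is injective on unit residues. [folklore] -/
theorem eq_of_below_eq {s s' : ZMod m} (hs : s.val.Coprime m) (hs' : s'.val.Coprime m)
    (h : below s = below s') : s = s' := by
  rcases lt_trichotomy s.val s'.val with hlt | heq | hgt
  · exact absurd h (below_lt_below_of_val_lt hs hlt).ne
  · exact ZMod.val_injective m heq
  · exact absurd h (below_lt_below_of_val_lt hs' hgt).ne'

/-- For `t` in the lower half every unit below `t` is in the lower half: `below t < |Lower|`. [folklore] -/
theorem below_lt_card_lower {t : ZMod m} (ht : t ∈ Lower) : below t < Finset.card Lower := by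
  have ht' := (mem_filter.mp ht).2
  calc below t < below t + 1 := Nat.lt_succ_self _
    _ = (insert t (Finset.univ.filter fun s : ZMod m => s.val.Coprime m ∧ s.val < t.val)).card := by
        rw [card_insert_of_notMem (by simp)]
    _ ≤ Finset.card Lower := by
        apply card_le_card
        intro u hu
        rcases mem_insert.mp hu with rfl | hu
        · exact ht
        · simp only [mem_filter, mem_univ, true_and] at hu ⊢
          exact ⟨hu.1, by omega⟩

/-- **The positions of the lower half are `0, 1, …, |Lower| − 1`**: `below` maps `Lower` onto
`range |Lower|`. [folklore] -/
theorem image_below_lower :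
    (Finset.image (fun t : ZMod m => below t) Lower) = range (Finset.card Lower) := by
  apply eq_of_subset_of_card_le
  · intro i hi
    obtain ⟨t, ht, rfl⟩ := mem_image.mp hi
    exact mem_range.mpr (below_lt_card_lower ht)
  · rw [card_range, card_image_of_injOn]
    intro s hs s' hs' h
    exact eq_of_below_eq (mem_filter.mp (mem_coe.mp hs)).2.1 (mem_filter.mp (mem_coe.mp hs')).2.1 h

/-- `#{i < 2k : i even} = k`. [folklore] -/
theorem card_filter_even_range (k : ℕ) : ((range (2 * k)).filter fun i => Even i).card = k := by
  induction k with
  | zero => simp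
  | succ k ih =>
    rw [show 2 * (k + 1) = 2 * k + 1 + 1 by ring, range_add_one, range_add_one, filter_insert, filter_insert,
      if_neg (by simp), if_pos (by simp)]
    rw [card_insert_of_notMem (by simp), ih]

/-- **Half of the lower half sits at odd positions**: `#{t ∈ Lower : below t even} = |Lower|/2` when
`|Lower|` is even. [folklore] -/
theorem card_lower_inter_nodd {g : ℕ} (hL : Finset.card Lower = 2 * g) :
    (Finset.filter (fun t : ZMod m => Even (below t)) Lower).card = g := by
  have hinj : Set.InjOn (fun t : ZMod m => below t) (Lower : Finset (ZMod m)) := fun s hs s' hs' h =>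
    eq_of_below_eq (mem_filter.mp (mem_coe.mp hs)).2.1 (mem_filter.mp (mem_coe.mp hs')).2.1 h
  have h1 : (Finset.filter (fun t : ZMod m => Even (below t)) Lower).card =
      ((Finset.filter (fun t : ZMod m => Even (below t)) Lower).image fun t : ZMod m => below t).card := by
    rw [card_image_of_injOn (fun s hs s' hs' h => hinj (mem_coe.mpr (mem_filter.mp (mem_coe.mp hs)).1)
      (mem_coe.mpr (mem_filter.mp (mem_coe.mp hs')).1) h)]
  rw [h1, ← filter_image, image_below_lower, hL, card_filter_even_range]

/-! ### §5 THEOREM F (F1), closed form at residue level -/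

/-- **`|Lower ∖ Nodd| = |Lower|/2`** and **`|Nodd ∖ Lower| = |Lower|/2`** (symmetry of `∖` on CM type sets).
research route conditional on HC_CM; not a corollary; Q11.4-sentence-2 already refuted in dim ≥ 3. [folklore] -/
theorem card_nodd_sdiff_lower (hm : 2 < m) {g : ℕ} (hL : Finset.card Lower = 2 * g) :
    (Nodd \ Lower).card = g := by
  have hm1 : 1 < m := by omega
  have hU : Even (Finset.card 𝑈) := ⟨Finset.card Lower, by
    have := two_mul_card_eq_card_units (isCMTypeSet_lower hm); omega⟩
  rw [card_sdiff_comm (isCMTypeSet_nodd hm1 hU) (isCMTypeSet_lower hm)]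
  have hsplit := card_sdiff_add_card_inter Lower Nodd
  have hint : (Lower ∩ Nodd) = Finset.filter (fun t : ZMod m => Even (below t)) Lower := by
    ext t; simp only [mem_inter, mem_filter, mem_univ, true_and]; tauto
  rw [hint, card_lower_inter_nodd hL, hL] at hsplit
  omega

/-- **THEOREM F (F1), residue level, every `m > 2`**: for a CM type set `N_K` (in the census: the
residues conjugating the imaginary quadratic `K`) and an `N_K`-BALANCED CM type set `S`
(`2·|S ∩ N_K| = |S|`, the Weil signature `(n,n)`), the census's bit is
`|S ∩ Nodd| ≡ n₋ := #{t ∈ N_K : 2t < m} (mod 2)` — independent of `S`, = b01.28's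
`n₋(M,K) = #{0 < t < M/2 : (t,M) = 1, χ_K(t) = −1}`.  (`Nodd` = odd positions; its identification (F0)
with `{σ_t : Im σ_t(ξ₀) < 0}` is the analytic input NOT proved here.)
research route conditional on HC_CM; not a corollary; Q11.4-sentence-2 already refuted in dim ≥ 3. [folklore] -/
theorem card_inter_nodd_mod_two_eq (hm : 2 < m) {S NK : Finset (ZMod m)} (hS : IsCMTypeSet m S)
    (hNK : IsCMTypeSet m NK) (hbal : 2 * (S ∩ NK).card = S.card) :
    (S ∩ Nodd).card % 2 = (NK.filter fun t : ZMod m => 2 * t.val < m).card % 2 := by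
  have hm1 : 1 < m := by omega
  -- cardinalities: |S| = |NK| = |Lower| = |U|/2 =: G, and G = 2g is even by balance
  have hSU := two_mul_card_eq_card_units hS
  have hNKU := two_mul_card_eq_card_units hNK
  have hLU := two_mul_card_eq_card_units (isCMTypeSet_lower hm)
  have hU : Even (Finset.card 𝑈) := ⟨S.card, by omega⟩
  have hN := isCMTypeSet_nodd hm1 hU
  have hNoU := two_mul_card_eq_card_units hN
  set g := (S ∩ NK).card with hg
  have hL : Finset.card Lower = 2 * g := by omega
  -- (1) pair count for (S; Nodd, NK):  |S∩Nodd| + |S∩NK| + |Nodd \ NK| even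
  have h1 := even_card_inter_add hS hN hNK
  -- (2) pair count for (NK; Nodd, Lower): |NK∩Nodd| + |NK∩Lower| + |Nodd \ Lower| even
  have h2 := even_card_inter_add hNK hN (isCMTypeSet_lower hm)
  -- |Nodd \ NK| = |NK \ Nodd| = |NK| - |NK ∩ Nodd|
  have h3 : (Nodd \ NK).card = (NK \ Nodd).card := card_sdiff_comm hN hNK
  have h4 := card_sdiff_add_card_inter NK Nodd
  -- |Nodd \ Lower| = g
  have h5 := card_nodd_sdiff_lower hm hL
  -- n₋ = |NK ∩ Lower|
  have h6 : (NK.filter fun t : ZMod m => 2 * t.val < m) = NK ∩ Lower := by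
    ext t
    simp only [mem_filter, mem_inter, mem_univ, true_and]
    constructor
    · rintro ⟨ht, hlt⟩; exact ⟨ht, hNK.1 t ht, hlt⟩
    · rintro ⟨ht, -, hlt⟩; exact ⟨ht, hlt⟩
  rw [h6]
  rcases h1 with ⟨a, ha⟩
  rcases h2 with ⟨b, hb⟩
  omega


/-! ### §6 The census level `M = 21` (b01.23 (B)–(C), b01.28 (F3): «21: √−7 yes / √−3 NO») -/

/-- **The census's `N` at `M = 21`**: the odd positions of `(ℤ/21)ˣ = {1,2,4,5,8,10,11,13,16,17,19,20}` are
`{1, 4, 8, 11, 16, 19}` (= `Ring2WeilCoverageCMTypeSignParityLevel21`'s `N₄₂ = {1, 11, 19, 25, 29, 37}` read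
through `t ↦ t mod 21` on odd representatives).
research route conditional on HC_CM; not a corollary; Q11.4-sentence-2 already refuted in dim ≥ 3. [folklore] -/
theorem nodd_twentyOne_eq :
    (Finset.univ.filter fun t : ZMod 21 => t.val.Coprime 21 ∧
      Even (Finset.card (Finset.filter (fun s : ZMod 21 => s.val.Coprime 21 ∧ s.val < t.val) Finset.univ))) =
      ({1, 4, 8, 11, 16, 19} : Finset (ZMod 21)) := by
  decide

/-- **`n₋(21, ℚ(√-3)) = 3`** (odd ⟹ the NO-bit): `N_{ℚ(√-3)} = {t ∈ (ℤ/21)ˣ : t ≡ 2 (mod 3)} =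
{2, 5, 8, 11, 17, 20}` has three elements below `21/2`.
research route conditional on HC_CM; not a corollary; Q11.4-sentence-2 already refuted in dim ≥ 3. [folklore] -/
theorem nminus_twentyOne_three :
    (({2, 5, 8, 11, 17, 20} : Finset (ZMod 21)).filter fun t : ZMod 21 => 2 * t.val < 21).card = 3 := by
  decide

/-- **`n₋(21, ℚ(√-7)) = 2`** (even ⟹ the YES-bit, row `W6.7.1`): `N_{ℚ(√-7)} = {t ∈ (ℤ/21)ˣ : (t/7) = −1} =
{5, 10, 13, 17, 19, 20}` has two elements below `21/2`.
research route conditional on HC_CM; not a corollary; Q11.4-sentence-2 already refuted in dim ≥ 3. [folklore] -/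
theorem nminus_twentyOne_seven :
    (({5, 10, 13, 17, 19, 20} : Finset (ZMod 21)).filter fun t : ZMod 21 => 2 * t.val < 21).card = 2 := by
  decide

/-- **THEOREM F (F1) at `(21, ℚ(√-3))` from the general law**: every `N_{ℚ(√-3)}`-balanced CM type set `S`
of `(ℤ/21)ˣ` meets the odd positions `{1, 4, 8, 11, 16, 19}` in an ODD number of residues (no `decide` over
`S`: `card_inter_nodd_mod_two_eq` + `n₋ = 3`; cf. the mod-42 `decide` of `…Level21`).
research route conditional on HC_CM; not a corollary; Q11.4-sentence-2 already refuted in dim ≥ 3. [folklore] -/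
theorem odd_card_inter_nodd_twentyOne_three {S : Finset (ZMod 21)} (hS : IsCMTypeSet 21 S)
    (hbal : 2 * (S ∩ ({2, 5, 8, 11, 17, 20} : Finset (ZMod 21))).card = S.card) :
    Odd ((S ∩ ({1, 4, 8, 11, 16, 19} : Finset (ZMod 21))).card) := by
  have hK : IsCMTypeSet 21 ({2, 5, 8, 11, 17, 20} : Finset (ZMod 21)) := by decide
  have h := card_inter_nodd_mod_two_eq (m := 21) (by norm_num) hS hK hbal
  rw [nodd_twentyOne_eq, nminus_twentyOne_three] at h
  exact Nat.odd_iff.mpr h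

/-- **THEOREM F (F1) at `(21, ℚ(√-7))` from the general law**: every `N_{ℚ(√-7)}`-balanced CM type set `S`
of `(ℤ/21)ˣ` meets `{1, 4, 8, 11, 16, 19}` in an EVEN number of residues.
research route conditional on HC_CM; not a corollary; Q11.4-sentence-2 already refuted in dim ≥ 3. [folklore] -/
theorem even_card_inter_nodd_twentyOne_seven {S : Finset (ZMod 21)} (hS : IsCMTypeSet 21 S)
    (hbal : 2 * (S ∩ ({5, 10, 13, 17, 19, 20} : Finset (ZMod 21))).card = S.card) :
    Even ((S ∩ ({1, 4, 8, 11, 16, 19} : Finset (ZMod 21))).card) := by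
  have hK : IsCMTypeSet 21 ({5, 10, 13, 17, 19, 20} : Finset (ZMod 21)) := by decide
  have h := card_inter_nodd_mod_two_eq (m := 21) (by norm_num) hS hK hbal
  rw [nodd_twentyOne_eq, nminus_twentyOne_seven] at h
  exact Nat.even_iff.mpr h

end Summit.HodgeConjecture.Ring2WeilCoverage.CMTypeSetOddPositions
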